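import Literature.Geometry.Lorentzian.CarterSliverKernelBookkeeping
import HarnessLib

/-!
# The smallness conditions of the threshold sliver from `ξ₁ ≤ 10⁻¹⁸θ₁⁴min(θ, 1)` and
# `Λ ≥ 1.5·10¹⁴/θ₁³`: atoms and the fuzz
(namespace `Literature.Geometry.Lorentzian.Kerr`.)

Bookkeeping for `CarterSliverRegimeKernel.sliverRegime_kernel_le`: its hypotheses on the fuzz
(`3.5·10¹⁰f²/θ₁³ ≤ Λ′`, `E* ≤ θ₁Λ′/12288`) and on the cap (`2X* ≤ θ(r₊ − r₋)`, `X* ≤ r₊ − r₋`, the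
`K`-condition, `A_cap X* ≤ 1`, `8ε_c² ≤ …`, `r₃ ≤ r₊ + min(r₊ − r₋, θ₁r₊/8)`, `r₃ ≤ r₊ + θ(r₊ − r₋)`)
hold for every admissible cone frequency with `0 < m`, BF margin `θ₁ ∈ (0, 1]`, in the sliver
`|ω − mω₊| ≤ 2ξ₁κ` with `ξ₁ ≤ 10⁻¹⁸θ₁⁴min(θ, 1)`, once `Λ ≥ 1.5·10¹⁴/θ₁³`:

* `sliver_atoms` — the common atoms;
* `sliver_fuzz_small` — the two fuzz conditions.

(The cap conditions are `CarterSliverCapSmallness`, the logarithmic length condition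
`CarterSliverLogSmallness`.) Elementary: `|S| ≤ ξ₁(r₊ − r₋)`,
`M|ω| ≤ √Λ`, `Λ/256 ≤ Λ′ ≤ 3Λ`, `r₊² + a² = 2Mr₊`, `r₊ − r₋ = 2(r₊² + a²)κ`. Near-extremal Kerr
programme, crux `KappaExplicitWaveDecay`.

## References
* M. Dafermos, I. Rodnianski, Y. Shlapentokh-Rothman, arXiv:1402.7034 = Ann. of Math. 183 (2016),
  §8 (key `DafermosRodnianskiShlapentokhrothman2014`). Folklore arithmetic.
-/

noncomputable section

open Set

namespace Literature.Geometry.Lorentzian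

namespace Kerr

section SliverSmallness

variable {M a ω Λ θ θ₁ ξ₁ ε₀ : ℝ} {m : ℤ}

/-- Common atoms of the sliver bookkeeping: `1 ≤ Λ`, `M|ω| ≤ √Λ`, `Λ/256 ≤ Λ′ ≤ 3Λ`,
`r₊² + a² = 2Mr₊`, `r₊ − r₋ = 2(r₊² + a²)κ`, `|S| ≤ ξ₁(r₊ − r₋)`. [folklore] -/
theorem sliver_atoms (hMa : IsSubextremal M a) (ha : M / 2 ≤ |a|) (hadm : IsAdmissibleTriple a ω m Λ)
    (hm : 0 < m) (hε₀ : ε₀ ≤ 1 / (16 * M)) (hcone : |ω - m * horizonAngularVelocity M a| ≤ ε₀ * |(m : ℝ)|)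
    (hθ₁ : 0 ≤ θ₁) (hBF : (1 + θ₁) * (2 * rPlus M a * ω) ^ 2 ≤ Λ - 2 * a * m * ω)
    (hσ : |ω - m * horizonAngularVelocity M a| ≤ 2 * ξ₁ * surfaceGravity M a) :
    1 ≤ Λ ∧ M * |ω| ≤ Real.sqrt Λ ∧ 1 ≤ Real.sqrt Λ ∧ Real.sqrt Λ ^ 2 = Λ ∧
    Λ / 256 ≤ Λ - 2 * a * m * ω ∧ |Λ - 2 * a * m * ω| ≤ 3 * Λ ∧
    rPlus M a ^ 2 + a ^ 2 = 2 * M * rPlus M a ∧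
    rPlus M a - rMinus M a = 2 * (rPlus M a ^ 2 + a ^ 2) * surfaceGravity M a ∧
    |(rPlus M a ^ 2 + a ^ 2) * (ω - m * horizonAngularVelocity M a)| ≤ ξ₁ * (rPlus M a - rMinus M a) := by
  have haM : |a| ≤ M := le_of_lt hMa
  have hM : 0 < M := hMa.pos
  have hrp : 0 < rPlus M a := rPlus_pos hM a
  obtain ⟨-, hωm, -⟩ := cone_abs_omega_bounds hM haM ha hm hε₀ hcone
  have hm1 : (1 : ℝ) ≤ m := by exact_mod_cast hm
  have hm2 := hadm.sq_le
  have hΛ1 : 1 ≤ Λ := by nlinarith only [hm2, hm1]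
  have hs := Real.sq_sqrt (show (0:ℝ) ≤ Λ by linarith only [hΛ1])
  have hs1 : 1 ≤ Real.sqrt Λ := by rw [← Real.sqrt_one]; exact Real.sqrt_le_sqrt hΛ1
  have hmle : (m : ℝ) ≤ Real.sqrt Λ := by
    rw [← Real.sqrt_sq (by linarith only [hm1] : (0:ℝ) ≤ m)]; exact Real.sqrt_le_sqrt hm2
  have hMω : M * |ω| ≤ Real.sqrt Λ := by
    have : M * |ω| ≤ m := by rw [le_div_iff₀ hM] at hωm; linarith only [hωm]
    exact this.trans hmle
  have hΛ' := lambdaPrime_ge_of_margin hM haM ha hm hε₀ hcone hθ₁ hBF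
  have hΛ'3 : |Λ - 2 * a * m * ω| ≤ 3 * Λ := by
    have h1 : |2 * a * m * ω| ≤ 2 * Λ := by
      rw [abs_mul, abs_mul, abs_mul, abs_of_pos (by norm_num : (0:ℝ) < 2),
        abs_of_pos (by linarith only [hm1] : (0:ℝ) < m)]
      have h2 : |a| * |ω| ≤ Real.sqrt Λ := (mul_le_mul_of_nonneg_right haM (abs_nonneg _)).trans hMω
      calc 2 * |a| * m * |ω| = 2 * m * (|a| * |ω|) := by ring
        _ ≤ 2 * Real.sqrt Λ * Real.sqrt Λ := by gcongr
        _ = 2 * Λ := by rw [mul_assoc, ← sq, hs]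
    have := abs_sub (Λ) (2 * a * m * ω)
    rw [abs_of_pos (by linarith only [hΛ1] : (0:ℝ) < Λ)] at this
    linarith only [this, h1]
  have hP : rPlus M a ^ 2 + a ^ 2 = 2 * M * rPlus M a := rPlus_sq_add_sq haM
  have hd := rPlus_sub_rMinus_eq_mul_surfaceGravity (a := a) hM
  have hAp : 0 < rPlus M a ^ 2 + a ^ 2 := by positivity
  have hS : |(rPlus M a ^ 2 + a ^ 2) * (ω - m * horizonAngularVelocity M a)| ≤
      ξ₁ * (rPlus M a - rMinus M a) := by
    rw [abs_mul, abs_of_pos hAp, hd]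
    have := mul_le_mul_of_nonneg_left hσ hAp.le
    nlinarith only [this]
  exact ⟨hΛ1, hMω, hs1, hs, hΛ', hΛ'3, hP, hd, hS⟩

/-- **The fuzz conditions of the sliver.** Under the atoms' hypotheses with `0 < θ₁ ≤ 1`,
`ξ₁ ≤ 10⁻¹⁸θ₁⁴` and `1.5·10¹⁴/θ₁³ ≤ Λ`: `3.5·10¹⁰(1 + 25E*/θ₁)²/θ₁³ ≤ Λ′` and `E* ≤ θ₁Λ′/12288`.
[folklore] -/
theorem sliver_fuzz_small (hMa : IsSubextremal M a) (ha : M / 2 ≤ |a|) (hadm : IsAdmissibleTriple a ω m Λ)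
    (hm : 0 < m) (hε₀ : ε₀ ≤ 1 / (16 * M)) (hcone : |ω - m * horizonAngularVelocity M a| ≤ ε₀ * |(m : ℝ)|)
    (hθ₁ : 0 < θ₁) (hθ₁1 : θ₁ ≤ 1) (hBF : (1 + θ₁) * (2 * rPlus M a * ω) ^ 2 ≤ Λ - 2 * a * m * ω)
    (hξ₁ : 0 ≤ ξ₁) (hξ₁le : ξ₁ ≤ 1e-18 * θ₁ ^ 4)
    (hσ : |ω - m * horizonAngularVelocity M a| ≤ 2 * ξ₁ * surfaceGravity M a)
    (hΛmin : 1.5e14 / θ₁ ^ 3 ≤ Λ) {Es : ℝ}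
    (hEs : Es = ((rPlus M a ^ 2 + a ^ 2) * (ω - m * horizonAngularVelocity M a)) ^ 2 / (θ₁ * M / 8) ^ 2 +
      2 * |(rPlus M a ^ 2 + a ^ 2) * (ω - m * horizonAngularVelocity M a)| * |ω| *
        (1 + (rPlus M a + rMinus M a) / (θ₁ * M / 8))) :
    3.5e10 * (1 + 25 * Es / θ₁) ^ 2 / θ₁ ^ 3 ≤ Λ - 2 * a * m * ω ∧
    Es ≤ θ₁ * (Λ - 2 * a * m * ω) / 12288 := by
  have hM : 0 < M := hMa.pos
  obtain ⟨hΛ1, hMω, hs1, hs, hΛ', -, -, -, -⟩ := sliver_atoms hMa ha hadm hm hε₀ hcone hθ₁.le hBF hσ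
  have hE := sliverFuzz_le (ω := ω) (m := m) hMa hθ₁ hθ₁1 hξ₁ hσ
  rw [← hEs] at hE
  set s := Real.sqrt Λ with hsdef
  have hθ4 : θ₁ ^ 4 ≤ θ₁ := by
    have h3 : θ₁ ^ 3 ≤ 1 := pow_le_one₀ hθ₁.le hθ₁1
    have := mul_le_mul_of_nonneg_right h3 hθ₁.le
    have e : θ₁ ^ 3 * θ₁ = θ₁ ^ 4 := by ring
    linarith only [this, e]
  have hξθ : ξ₁ ≤ 1e-18 * θ₁ := hξ₁le.trans (by linarith only [hθ4])
  have hξ1 : ξ₁ ≤ 1e-18 := hξθ.trans (by linarith only [hθ₁1, hθ₁])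
  -- `E* ≤ 256ξ₁²/θ₁² + 68ξ₁M|ω|/θ₁ ≤ 2.56·10⁻³⁴θ₁⁶ + 6.8·10⁻¹⁷ θ₁³ √Λ`
  have hE1 : 256 * ξ₁ ^ 2 / θ₁ ^ 2 ≤ 2.56e-34 * θ₁ ^ 6 := by
    rw [div_le_iff₀ (by positivity)]
    have : ξ₁ ^ 2 ≤ (1e-18 * θ₁ ^ 4) ^ 2 := pow_le_pow_left₀ hξ₁ hξ₁le 2
    have e : (1e-18 * θ₁ ^ 4) ^ 2 * 256 = 2.56e-34 * θ₁ ^ 6 * θ₁ ^ 2 := by ring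
    linarith only [this, e]
  have hE2 : 68 * ξ₁ * M * |ω| / θ₁ ≤ 6.8e-17 * θ₁ ^ 3 * s := by
    rw [div_le_iff₀ hθ₁]
    have h1 : 68 * ξ₁ * M * |ω| ≤ 68 * (1e-18 * θ₁ ^ 4) * s := by
      calc 68 * ξ₁ * M * |ω| = 68 * ξ₁ * (M * |ω|) := by ring
        _ ≤ 68 * (1e-18 * θ₁ ^ 4) * s := by gcongr
    have e : 68 * (1e-18 * θ₁ ^ 4) * s = 6.8e-17 * θ₁ ^ 3 * s * θ₁ := by ring
    linarith only [h1, e]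
  have hsum : rPlus M a + rMinus M a = 2 * M := by unfold rPlus rMinus; ring
  have hEs0 : 0 ≤ Es := by rw [hEs, hsum]; positivity
  have hEle : Es ≤ 2.56e-34 * θ₁ ^ 6 + 6.8e-17 * θ₁ ^ 3 * s := by linarith only [hE, hE1, hE2]
  have hθ6 : θ₁ ^ 6 ≤ θ₁ := by
    have h5 : θ₁ ^ 5 ≤ 1 := pow_le_one₀ hθ₁.le hθ₁1
    have := mul_le_mul_of_nonneg_right h5 hθ₁.le
    have e : θ₁ ^ 5 * θ₁ = θ₁ ^ 6 := by ring
    linarith only [this, e]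
  have hs0 : 0 ≤ s := by linarith only [hs1]
  constructor
  · -- `f ≤ 2 + 1.7·10⁻¹⁵ θ₁² √Λ`, `f² ≤ 8 + 5.78·10⁻³⁰ θ₁⁴ Λ`
    set g := 1.7e-15 * θ₁ ^ 2 * s with hg
    have hg0 : 0 ≤ g := by positivity
    have hf : 1 + 25 * Es / θ₁ ≤ 2 + g := by
      have h1 : 25 * Es / θ₁ ≤ 25 * (2.56e-34 * θ₁ ^ 6 + 6.8e-17 * θ₁ ^ 3 * s) / θ₁ :=
        div_le_div_of_nonneg_right (by linarith only [hEle]) hθ₁.le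
      have h2 : 25 * (2.56e-34 * θ₁ ^ 6 + 6.8e-17 * θ₁ ^ 3 * s) / θ₁ = 6.4e-33 * θ₁ ^ 5 + g := by
        rw [hg]; field_simp; ring
      have h3 : 6.4e-33 * θ₁ ^ 5 ≤ 1 := by
        have : θ₁ ^ 5 ≤ 1 := pow_le_one₀ hθ₁.le hθ₁1; linarith only [this]
      linarith only [h1, h2, h3]
    have hf0 : 0 ≤ 1 + 25 * Es / θ₁ := by positivity
    have hf2 : (1 + 25 * Es / θ₁) ^ 2 ≤ 8 + 2 * g ^ 2 := by
      have h4 := pow_le_pow_left₀ hf0 hf 2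
      have h5 : (2 + g) ^ 2 ≤ 8 + 2 * g ^ 2 := by nlinarith only [sq_nonneg (2 - g)]
      exact h4.trans h5
    have hg2 : 2 * g ^ 2 = 5.78e-30 * θ₁ ^ 4 * Λ := by
      rw [hg, mul_pow, mul_pow, ← hs]; ring
    rw [hg2] at hf2
    -- `3.5e10 (8 + 5.78e-30 θ₁⁴Λ)/θ₁³ ≤ Λ/256 ≤ Λ′`
    refine le_trans ?_ hΛ'
    rw [div_le_iff₀ (by positivity)]
    have hθ3 : 0 < θ₁ ^ 3 := pow_pos hθ₁ 3
    have h1 : 1.5e14 ≤ Λ * θ₁ ^ 3 := by rwa [div_le_iff₀ hθ3] at hΛmin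
    have h2 : θ₁ ^ 7 ≤ θ₁ ^ 3 := pow_le_pow_of_le_one hθ₁.le hθ₁1 (by norm_num)
    -- `3.5e10 (8 + 5.78e-30 θ₁⁴ Λ) ≤ Λ θ₁³/256`
    have h3 : 3.5e10 * (1 + 25 * Es / θ₁) ^ 2 ≤ 3.5e10 * (8 + 5.78e-30 * θ₁ ^ 4 * Λ) :=
      mul_le_mul_of_nonneg_left hf2 (by norm_num)
    have h5 : θ₁ ^ 4 * Λ ≤ θ₁ ^ 3 * Λ := by
      have : θ₁ ^ 4 ≤ θ₁ ^ 3 := pow_le_pow_of_le_one hθ₁.le hθ₁1 (by norm_num)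
      exact mul_le_mul_of_nonneg_right this (by linarith only [hΛ1])
    linarith only [h3, h1, h5]
  · -- `E* ≤ θ₁Λ/(256·12288) ≤ θ₁Λ′/12288`
    have h1 : 2.56e-34 * θ₁ ^ 6 + 6.8e-17 * θ₁ ^ 3 * s ≤ θ₁ * (Λ / 256) / 12288 := by
      have hθΛ : 0 < θ₁ * Λ := mul_pos hθ₁ (by linarith only [hΛ1])
      have h2 : 2.56e-34 * θ₁ ^ 6 ≤ θ₁ * Λ / 6.3e6 := by
        rw [le_div_iff₀ (by norm_num)]
        have := mul_le_mul hθ6 hΛ1 zero_le_one hθ₁.le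
        nlinarith only [this, pow_nonneg hθ₁.le 6]
      have h3 : 6.8e-17 * θ₁ ^ 3 * s ≤ θ₁ * Λ / 6.3e6 := by
        rw [le_div_iff₀ (by norm_num), ← hs]
        have h4 : θ₁ ^ 3 ≤ θ₁ := by
          have h6 : θ₁ ^ 2 ≤ 1 := pow_le_one₀ hθ₁.le hθ₁1
          have := mul_le_mul_of_nonneg_right h6 hθ₁.le
          have e : θ₁ ^ 2 * θ₁ = θ₁ ^ 3 := by ring
          linarith only [this, e]
        have hss : s ≤ s * s := by nlinarith only [hs1]
        have h5 : θ₁ ^ 3 * s ≤ θ₁ * (s * s) := mul_le_mul h4 hss hs0 hθ₁.le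
        have e2 : s ^ 2 = s * s := sq s
        nlinarith only [h5, e2, mul_nonneg hθ₁.le (mul_nonneg hs0 hs0)]
      have e : θ₁ * (Λ / 256) / 12288 = θ₁ * Λ / 3145728 := by ring
      rw [e]
      have : θ₁ * Λ / 6.3e6 + θ₁ * Λ / 6.3e6 ≤ θ₁ * Λ / 3145728 := by
        rw [← add_div, div_le_div_iff₀ (by norm_num) (by norm_num)]
        nlinarith only [hθΛ]
      linarith only [h2, h3, this]
    calc Es ≤ 2.56e-34 * θ₁ ^ 6 + 6.8e-17 * θ₁ ^ 3 * s := hEle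
      _ ≤ θ₁ * (Λ / 256) / 12288 := h1
      _ ≤ θ₁ * (Λ - 2 * a * m * ω) / 12288 := by gcongr


end SliverSmallness

end Kerr

end Literature.Geometry.Lorentzian

end
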